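import Literature.Analysis.FluidPDE.DynamicRescalingBlowup
import Literature.Analysis.FluidPDE.TaoEnstrophyLocalisation
import HarnessLib

/-!
# Vorticity blow-up inside a bounded region makes the lifespan maximal

Topic `Literature/Analysis/FluidPDE`; glue between the blow-up predicate
`VorticityBlowsUpOnAt Ω u T` (`Axisymmetric.lean`: `∀ M, ∃ᶠ t ↑ T, ∃ x ∈ Ω, M < ‖curl u(t, x)‖`,
the Beale–Kato–Majda / Chen–Hou form of singularity formation in a domain) and the continuation
vocabulary of `ClassicalSolution.lean` (`HasSmoothExtensionPast`, `IsMaximalSmoothSolution`, the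
shape of the blow-up decls of the NavierStokesRegularity routes Blowup / CertifiedBlowup).

* `IsSmoothSpaceTimeOn.exists_bound_norm_curl`: the vorticity of a jointly smooth field on
  `[0, T') × ℝ³` is bounded on `[0, T] × K` for `T < T'` and `K` compact (continuity of the
  slice derivative, `IsSmoothSpaceTimeOn.fderiv_slice`, on a compact set).
* `VorticityBlowsUpOnAt.not_hasSmoothExtensionPast`: if the vorticity blows up at `T > 0` inside a
  BOUNDED region `Ω`, no classical solution on a longer interval `[0, T')` agrees with `u` on
  `[0, T)` — the elementary half of the BKM continuation principle (Beale–Kato–Majda 1984, §1; for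
  `Ω = ℝ³` the statement is false as typed, since a smooth extension need not have bounded
  vorticity on the whole space, whence the boundedness hypothesis).
* `VorticityBlowsUpOnAt.isMaximalSmoothSolution`: hence a classical solution on `[0, T)` whose
  vorticity blows up inside a bounded region is a maximal smooth solution with lifespan `T`.
* `isMaximalSmoothSolution_of_rescaling`: combined with `vorticityBlowsUpOnAt_of_rescaling`
  (`DynamicRescalingBlowup.lean`): a classical solution on `[0, t(∞))` whose rescaled vorticity
  stays nontrivial at points of a bounded region (the output of a dynamic-rescaling / modulation
  stability theorem à la Chen–Hou, CMP 2021 §4.1, Part I arXiv:2210.07191 §6.5) is maximal with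
  lifespan `T = t(∞)` — the `IsMaximalSmoothSolution` conjunct of the blow-up decls.

No fluid equation is used beyond the smoothness packaged in `IsClassicalNSSolutionOn`.
-/

noncomputable section

open Set Filter Function Bornology MeasureTheory
open _root_.Topology

namespace Literature.Analysis.FluidPDE

section Bound

variable {T T' : ℝ} {w : ℝ → EuclideanSpace ℝ (Fin 3) → EuclideanSpace ℝ (Fin 3)}

/-- The vorticity `(t, x) ↦ curl (w t) x` of a jointly smooth field on `[0, T') × ℝ³` is jointly
continuous there (`curl = curlCLM ∘ D`, and the slice derivative is jointly smooth). [folklore] -/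
theorem IsSmoothSpaceTimeOn.continuousOn_curl {S : Set ℝ} (h : IsSmoothSpaceTimeOn S w)
    (hS : UniqueDiffOn ℝ S) :
    ContinuousOn (uncurry fun t x => curl (w t) x) (S ×ˢ univ) := by
  have hD : ContinuousOn (uncurry fun t x => fderiv ℝ (w t) x) (S ×ˢ univ) :=
    (h.fderiv_slice hS).continuousOn
  have heq : (uncurry fun t x => curl (w t) x) =
      (curlCLM : (EuclideanSpace ℝ (Fin 3) →L[ℝ] EuclideanSpace ℝ (Fin 3)) →L[ℝ]
        EuclideanSpace ℝ (Fin 3)) ∘ (uncurry fun t x => fderiv ℝ (w t) x) := by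
    funext z
    rfl
  rw [heq]
  exact curlCLM.continuous.comp_continuousOn hD

/-- **Compact vorticity bound for a smooth field on a longer time interval**: if `w` is jointly
smooth on `[0, T') × ℝ³` and `T < T'`, then `‖curl (w t) x‖ ≤ M` for all `t ∈ [0, T]`, `x ∈ K`,
`K` compact. [folklore] -/
theorem IsSmoothSpaceTimeOn.exists_bound_norm_curl (h : IsSmoothSpaceTimeOn (Ico 0 T') w)
    (hTT' : T < T') {K : Set (EuclideanSpace ℝ (Fin 3))} (hK : IsCompact K) :
    ∃ M : ℝ, ∀ t ∈ Icc 0 T, ∀ x ∈ K, ‖curl (w t) x‖ ≤ M := by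
  have hcont := h.continuousOn_curl (uniqueDiffOn_Ico 0 T')
  have hsub : Icc 0 T ×ˢ K ⊆ Ico 0 T' ×ˢ (univ : Set (EuclideanSpace ℝ (Fin 3))) :=
    prod_mono (Icc_subset_Ico_right hTT') (subset_univ _)
  obtain ⟨M, hM⟩ := (isCompact_Icc.prod hK).exists_bound_of_continuousOn (hcont.mono hsub)
  exact ⟨M, fun t ht x hx => hM (t, x) (mk_mem_prod ht hx)⟩

end Bound

section Maximal

variable {Ω : Set (EuclideanSpace ℝ (Fin 3))}
  {u : ℝ → EuclideanSpace ℝ (Fin 3) → EuclideanSpace ℝ (Fin 3)} {T : ℝ}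

/-- **Vorticity blow-up inside a bounded region prevents classical continuation** (the elementary
half of the Beale–Kato–Majda continuation principle, [BealeKatoMajda1984] §1): if `0 < T`, `Ω` is
bounded and `VorticityBlowsUpOnAt Ω u T`, then `¬ HasSmoothExtensionPast ν f u T` for every
viscosity and force — a classical `(u', p')` on `[0, T')`, `T' > T`, agreeing with `u` on `[0, T)`
would have vorticity bounded on `[0, T] × closure Ω`, against the blow-up. [folklore] -/
theorem VorticityBlowsUpOnAt.not_hasSmoothExtensionPast (hΩ : IsBounded Ω) (hT : 0 < T)
    (h : VorticityBlowsUpOnAt Ω u T) (ν : ℝ)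
    (f : ℝ → EuclideanSpace ℝ (Fin 3) → EuclideanSpace ℝ (Fin 3)) :
    ¬ HasSmoothExtensionPast ν f u T := by
  rintro ⟨T', hTT', u', p', hcl, hagree⟩
  obtain ⟨M, hM⟩ :=
    hcl.smooth_velocity.exists_bound_norm_curl hTT' hΩ.isCompact_closure
  have hev : ∀ᶠ t in 𝓝[<] T, t ∈ Ico 0 T :=
    mem_nhdsLT_iff_exists_Ioo_subset.2 ⟨0, hT, fun t ht => ⟨ht.1.le, ht.2⟩⟩
  obtain ⟨t, ⟨x, hx, hMx⟩, ht⟩ := ((h M).and_eventually hev).exists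
  have hle : ‖curl (u' t) x‖ ≤ M := hM t ⟨ht.1, ht.2.le⟩ x (subset_closure hx)
  rw [hagree t ht] at hle
  exact absurd hMx (not_lt.2 hle)

/-- A classical solution on `[0, T)`, `T > 0`, whose vorticity blows up inside a bounded region is
a **maximal smooth solution with lifespan `T`**. [folklore] -/
theorem VorticityBlowsUpOnAt.isMaximalSmoothSolution (hΩ : IsBounded Ω) (hT : 0 < T)
    (h : VorticityBlowsUpOnAt Ω u T) {ν : ℝ}
    {f : ℝ → EuclideanSpace ℝ (Fin 3) → EuclideanSpace ℝ (Fin 3)}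
    {p : ℝ → EuclideanSpace ℝ (Fin 3) → ℝ} (hcl : IsClassicalNSSolutionOn (Ico 0 T) ν f u p) :
    IsMaximalSmoothSolution ν f u p T :=
  ⟨hcl, h.not_hasSmoothExtensionPast hΩ hT ν f⟩

/-- **Maximality from dynamic rescaling.** Let the factor `C = C_ω` be continuous, positive and
integrable on `(0, ∞)` (`T = t(∞) < ∞`), let `(u, p)` be a classical solution on `[0, T)`, and
suppose the rescaled vorticity stays nontrivial at points of a BOUNDED region `Ω`: for all large
`τ` some `x_τ ∈ Ω` has `m ≤ C(τ) ‖curl u(t(τ), x_τ)‖`, `m > 0` (the conclusion of a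
dynamic-rescaling stability theorem, [ChenHou2021Boundary] §4.1). Then `(u, p)` is a maximal
smooth solution with lifespan `T = blowupTime C`. [folklore] -/
theorem isMaximalSmoothSolution_of_rescaling {C : ℝ → ℝ} (hC : Continuous C) (hpos : ∀ τ, 0 < C τ)
    (hint : IntegrableOn C (Ioi 0)) (hΩ : IsBounded Ω) {m : ℝ} (hm : 0 < m)
    (hlow : ∀ᶠ τ in atTop, ∃ x ∈ Ω, m ≤ C τ * ‖curl (u (rescaledTime C τ)) x‖) {ν : ℝ}
    {f : ℝ → EuclideanSpace ℝ (Fin 3) → EuclideanSpace ℝ (Fin 3)}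
    {p : ℝ → EuclideanSpace ℝ (Fin 3) → ℝ}
    (hcl : IsClassicalNSSolutionOn (Ico 0 (blowupTime C)) ν f u p) :
    IsMaximalSmoothSolution ν f u p (blowupTime C) :=
  (vorticityBlowsUpOnAt_of_rescaling hC hpos hint hm hlow).isMaximalSmoothSolution hΩ
    (blowupTime_pos hC hpos hint) hcl

end Maximal

end Literature.Analysis.FluidPDE
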